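import Summits.QuantumFields.YangMills.Theorems.WeakCouplingRatesBulkDominatesColdBoxWKernelMeanTrunk
import Summits.QuantumFields.YangMills.Theorems.WeakCouplingRatesBulkDominatesColdBoxWKernelMeanPrelims
import Summits.QuantumFields.YangMills.Theorems.WeakCouplingRatesBulkDominatesColdBoxWDirKernelTwoPoint
import Summits.QuantumFields.YangMills.Theorems.BalabanLadderUVSeamRecColdWallLargeFieldPolyWindow
import Summits.QuantumFields.YangMills.Theorems.SixPlaneColdBoxFlatBoxMeanG
import HarnessLib

/-!
# Crux `UVSeamRec` (stmt-QuantumFields-20043), line «coldwall_pure»: THE COLD-WALL KERNEL MEAN IS SEMICLASSICAL ON THE WHOLE POLYNOMIAL WINDOW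
# `|β·E_{γ_H(·|𝟙)}[2 − Re tr U_q] − (3/2)·C_{D,H}(q,q)| ≤ β^{−θ}` for EVERY cold-wall box `H ≤ ⌈β^θ⌉`, every plaquette `q` touching it (`0 < θ ≤ 1/100`)

Helper file (`--supports stmt-QuantumFields-20043`) of the LEAD seat `ym-spine-20043-p1` (gen 14).  Director-ym R394 (a) item (1) asked for the
cold-wall ceiling `kerE^𝟙(2 − plane) ≤ C/β` UNIFORMLY in the box; gens 11–12 landed the box AVERAGE (92/β, every cube) and the FIXED-box
pointwise form (constant `∝ (2R+3)⁴`), and located the `R`-uniform pointwise statement in the class of cold-wall extremality (CWX).  This file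
imports the ONE-SCALE EXPANSION of the route `WeakCouplingRates` (crux `BulkDominatesColdBoxW`, fleet `ym-wcr-*`: forest gauge, product gnomonic
chart, cubic linearisation, Dirichlet-Gaussian representation with tilt, Wick — `abs_kernelMean_sub_le_of_trunk`) and INSTANTIATES IT AT THE
FLAT DATUM for EVERY box of half-side `H ≤ ⌈β^θ⌉` at once (the route's own stub `stub_kernelMeanExpansion` fixes `H = ⌈β^θ⌉` and hides the
background in an `∃`-witness; at the cold wall the background vanishes identically: `sdat_zero`, `ColdBoxAllGroups.sCirc_glue_zero_mean_zero`;
the line `SixPlaneColdBox` has the flat-datum mean to precision `β^{−1/4}` at the single size `H = ⌈β^θ⌉`, `θ ≤ 1/200`, near the centre, every compact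
`G` — `ColdBoxAllGroups.flatBoxMean_sharp`; the present file trades the rate for UNIFORMITY IN `H ≤ ⌈β^θ⌉` and every touching plaquette):
* §1 **`coldWall_kernelMean_sub_le`** — for `0 < θ ≤ 1/100`: eventually in `β`, for all `1 ≤ H ≤ ⌈β^θ⌉` and every plaquette `q = (x;i,j)` touching
  `boxEdges 4 (2H+1)`: `|β·∫ plaqCostAt q d(boxState β H) − (3/2)·boxDirProjKernel H q q| ≤ β^{−θ}` — the cold-wall kernel mean of the plaquette
  deficit IS the lattice-Maxwell Dirichlet variance (`×3/2`: three colours, `½` per Gaussian mode) up to `β^{−1−θ}`, on the whole polynomial window;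
* §2 `coldWall_kernelMean_le` ∕ `_ge` — the two one-sided readings with `0 ≤ C_{D,H}(q,q) ≤ 1` (`boxDirProjKernel_le_one_of_mem`):
  `β·E ≤ 5/2` and `β·E ≥ −β^{−θ}`… i.e. **the pointwise cold-wall ceiling `E_{γ_H(·|𝟙)}[2 − Re tr U_q] ≤ 5/(2β)` UNIFORMLY IN `1 ≤ H ≤ ⌈β^{1/100}⌉`**.
The sequel `…ColdWallKernelMeanPolyWindowCrux` rewrites §2–§3 in the crux's letters (`kerE`, `plane`, cubes `(x − R − 1, 2R + 3)`).
HONEST FRAMING: Tier 3 of tempered-d1's sizing on the POLYNOMIAL window `R + 1 ≤ ⌈β^{1/100}⌉` only — the femto window of (DR)/(CW)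
(`R ≤ ℓ/uRec β`, exponentially large boxes) is untouched and remains CWX-hard; nothing of E0′, NT or the gap; YM mass gap NOT proved; not Clay.
-/

set_option autoImplicit false

noncomputable section

open MeasureTheory Finset Filter
open Literature.Probability.LatticeModels (Site)
open Literature.MathematicalPhysics.QuantumLattice
open Literature.MathematicalPhysics.QuantumFieldTheory
open Literature.MathematicalPhysics.QuantumFieldTheory.LatticeMaxwell
open Literature.MathematicalPhysics.QuantumFieldTheory.AxialGauge
open Summit.QuantumFields.YangMills.Theorems.WeakCouplingRates
open Summit.QuantumFields.YangMills.Theorems.ColdBoxAllGroups (sCirc_glue_zero_mean_zero)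

namespace Summit.QuantumFields.YangMills.Cruxes.UVSeamRec.ClassicalResponse.ColdWall
/-! ### §1 The cold-wall kernel mean on the polynomial window -/

set_option maxHeartbeats 1600000 in
/-- **THE COLD-WALL KERNEL MEAN IS SEMICLASSICAL ON THE POLYNOMIAL WINDOW.**  For `0 < θ ≤ 1/100` there is `β₀` such that for all `β ≥ β₀`,
all half-sides `1 ≤ H ≤ ⌈β^θ⌉` and every plaquette `(x; i, j)` touching `boxEdges 4 (2H+1)`:
`|β · ∫ plaqCostAt (x;i,j) d(boxState β H) − (3/2)·boxDirProjKernel H (x,i,j) (x,i,j)| ≤ β^{−θ}`.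
Proof: the route's deterministic one-scale core `abs_kernelMean_sub_le_of_trunk` at the flat datum (`ϑ = 0`: `W ≡ 1`, background `≡ 0`), with
the route's numerics at `S = 2⌈β^θ⌉ + 3 ≥ 2H + 3` and the prelude `…ColdWallLargeFieldPolyWindow` for the large-field mass.  (One long assembly: the heartbeat budget is raised
for this declaration only, as in the route's `stub_kernelMeanExpansion`.) [folklore] -/
theorem coldWall_kernelMean_sub_le {θ : ℝ} (hθ : 0 < θ) (hθ₂ : θ ≤ 1 / 100) :
    ∃ β₀ : ℝ, ∀ β : ℝ, β₀ ≤ β → ∀ H : ℕ, 1 ≤ H → H ≤ ⌈β ^ θ⌉₊ →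
      ∀ (x : Site 4) (i j : Fin 4) (hij : i < j),
        ((x, ⟨(i, j), hij⟩) : ZdPlaquette 4) ∈ plaquettesTouching (boxEdges 4 (2 * H + 1)) →
        |β * (∫ U, plaqCostAt (fundamentalRep (Fin 2)) x i j U ∂(boxState (fundamentalRep (Fin 2)) β H)) -
            3 / 2 * boxDirProjKernel H (x, i, j) (x, i, j)| ≤ β ^ (-θ) := by
  have hε0 : (0 : ℝ) < 4 * θ := by positivity
  have h7θ : (0 : ℝ) < 7 * θ := by positivity
  obtain ⟨β₂, hrare⟩ := boxState_real_largeField_le_of_le_ceil (θ := θ) (ε := 4 * θ) hθ (by linarith)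
  obtain ⟨b, hb1', hnum⟩ := kernelMean_eventually hθ hθ₂
  refine ⟨max β₂ b, fun β hβ H hH1 hHc x i j hij hxt => ?_⟩
  simp only [max_le_iff] at hβ
  obtain ⟨hb2, hc⟩ := hβ
  have hβ1 : (1 : ℝ) ≤ β := hb1'.trans hc
  have hβ0 : 0 < β := by linarith
  have sqrt_two_le_two : Real.sqrt 2 ≤ 2 := by
    have h : Real.sqrt 2 ≤ Real.sqrt 4 := Real.sqrt_le_sqrt (by norm_num)
    rwa [show (4 : ℝ) = 2 ^ 2 by norm_num, Real.sqrt_sq (by norm_num)] at h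
  have hrareβ := hrare β hb2 H hHc
  obtain ⟨E1β, E2β, E3β, E4β, E5β, E6β, E7β, E8β, E9β, E10β, E11β, E12β⟩ := hnum β hc
  obtain ⟨hA2, hA4, hAhalf, h8θ, h12θ, h20θ, h16θ, h18θ, hεeq, hsqrtε, hDsq, hA2split⟩ := kernelMean_rpow_dictionary hβ0 θ
  obtain ⟨hreq, hsr, hrle, hr2eq⟩ := kernelMean_radius hβ0 hβ1 hθ
  obtain ⟨hH1r, hH2r⟩ := one_le_ceil_rpow_and_le hβ1 hθ.le
  -- the numerics' box side `S` dominates the box side of `H`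
  set S : ℝ := 2 * (⌈β ^ θ⌉₊ : ℝ) + 3 with hSdef
  have hHr1 : (1 : ℝ) ≤ (H : ℝ) := by exact_mod_cast hH1
  have hHrc : (H : ℝ) ≤ (⌈β ^ θ⌉₊ : ℝ) := by exact_mod_cast hHc
  have hHn0 : (0 : ℝ) ≤ (H : ℝ) := Nat.cast_nonneg _
  have hS1 : (1 : ℝ) ≤ S := by rw [hSdef]; linarith only [hH1r]
  have hS0 : 0 < S := by linarith only [hS1]
  have h2H1 : 2 * (H : ℝ) + 1 ≤ S := by rw [hSdef]; linarith only [hHrc]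
  have h4S : (2 * (H : ℝ) + 1) ^ 4 ≤ S ^ 4 := pow_le_pow_left₀ (by positivity) h2H1 4
  have hL : 12 * (H : ℝ) ^ 2 + 2 * H + 1 ≤ 3 * S ^ 2 := by rw [hSdef]; nlinarith only [hHn0, hHrc]
  -- the rpow dictionary: A = β^{4θ}, D = β^{3θ+θ/5}
  set A : ℝ := β ^ (4 * θ) with hAdef
  set D : ℝ := β ^ (3 * θ + θ / 5) with hDdef
  have hA1 : 1 ≤ A := Real.one_le_rpow hβ1 (by linarith)
  have hA0 : 0 < A := by linarith only [hA1]
  have hD0 : 0 ≤ D := Real.rpow_nonneg hβ0.le _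
  have hDA : D ≤ A := Real.rpow_le_rpow_of_exponent_le hβ1 (by linarith)
  have hsβ0 : 0 < Real.sqrt β := Real.sqrt_pos.2 hβ0
  have hsβsq : Real.sqrt β ^ 2 = β := Real.sq_sqrt hβ0.le
  -- the (idle) exterior radius `r` of the route's datum package
  set r : ℝ := Real.sqrt (2 * 278400 ^ 2 * β ^ (6 * θ + 2 * (θ / 5) - 1)) with hrdef
  have hr0 : 0 ≤ r := Real.sqrt_nonneg _
  -- the flat datum `ϑ = 0`
  have hϑ' : ∀ e, e ∉ boxEdges 4 (2 * H + 1) →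
      ∑ c, (0 : Fin 3 → Literature.MathematicalPhysics.QuantumLattice.ZdEdge 4 → ℝ) c e ^ 2 ≤ r ^ 2 := fun e _ => by
    simp only [Pi.zero_apply]; simp [sq_nonneg]
  have hforest : ∀ y : Site 4, (∀ k : Fin 4, 1 ≤ y k ∧ y k + 1 ≤ 2 * (H : ℤ)) →
      ∀ c, (0 : Fin 3 → Literature.MathematicalPhysics.QuantumLattice.ZdEdge 4 → ℝ) c (y, 0) = 0 := fun y _ c => rfl
  -- numeric inequalities at this β through the dictionary
  have e1 : 4 * 10 ^ 8 * S ^ 2 * (A / Real.sqrt β) ≤ 1 := by rw [hAhalf, Real.rpow_zero] at E1β; exact E1β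
  have e2 : 4 * 43440 * (10 ^ 8) ^ 3 * S ^ 10 * (A ^ 3 / Real.sqrt β) ≤ 1 := by rw [h12θ, Real.rpow_zero] at E2β; exact E2β
  have e3 : 4 * 8 * (10 ^ 8) ^ 2 * S ^ 8 * (A ^ 2 / β) ≤ 1 := by rw [h8θ, Real.rpow_zero] at E3β; exact E3β
  have e4 : 32 * 43440 * (10 ^ 8) ^ 3 * S ^ 10 * (A ^ 5 / Real.sqrt β) ≤ β ^ (-θ) := by rw [h20θ] at E4β; exact E4β
  have e5 : 32 * 8 * (10 ^ 8) ^ 2 * S ^ 8 * (A ^ 4 / β) ≤ β ^ (-θ) := by rw [h16θ] at E5β; exact E5β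
  have e6 : 4 * 362 * (10 ^ 8) ^ 3 * S ^ 6 * (A ^ 3 / Real.sqrt β) ≤ β ^ (-θ) := by rw [h12θ] at E6β; exact E6β
  have e7 : 7 * 362 * (10 ^ 8) ^ 3 * S ^ 6 * (A / Real.sqrt β) ≤ 1 := by rw [hAhalf, Real.rpow_zero] at E7β; exact E7β
  have e8 : 16 ≤ β ^ θ := by rw [Real.rpow_zero, mul_one] at E8β; exact E8β
  have e9 : 32 * β * Real.exp (-A) ≤ β ^ (-θ) := by rw [Real.rpow_one] at E9β; exact E9β
  have e10 : 12096 * 49 * (A ^ 4 * β ^ (2 * θ)) * Real.exp (-(β ^ (7 * θ))) ≤ β ^ (-θ) := by rw [h18θ] at E10β; exact E10β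
  have e11 : 1440 * S ^ 4 * Real.exp (-(β ^ (7 * θ))) ≤ 1 := by rw [Real.rpow_zero] at E11β; exact E11β
  have hA2ge : 16 * β ^ (7 * θ) ≤ A ^ 2 := by
    have h2 : 0 ≤ β ^ (7 * θ) := Real.rpow_nonneg hβ0.le _
    rw [hA2split]; nlinarith only [e8, h2]
  have hS2 : S ^ 2 ≤ 49 * β ^ (2 * θ) := by
    have h := boxSide_pow_le hβ1 hθ.le 2
    have hc' : ((2 : ℕ) : ℝ) * θ = 2 * θ := by push_cast; ring
    have h49 : (7 : ℝ) ^ 2 = 49 := by norm_num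
    rw [hc', h49] at h
    rw [hSdef]; exact h
  -- the parameters of the deterministic core
  set m : ℝ := 10 ^ 8 * S ^ 2 * (A / Real.sqrt β) with hmdef
  have hm0 : 0 ≤ m := by positivity
  have hm4 : m ≤ 1 / 4 := by rw [hmdef]; linarith only [e1]
  have hm2 : m ^ 2 = (10 ^ 8) ^ 2 * S ^ 4 * (A ^ 2 / β) := by
    rw [hmdef, show (10 ^ 8 * S ^ 2 * (A / Real.sqrt β)) ^ 2 = (10 ^ 8) ^ 2 * S ^ 4 * (A ^ 2 / Real.sqrt β ^ 2) by ring, hsβsq]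
  have hm3 : m ^ 3 = (10 ^ 8) ^ 3 * S ^ 6 * (A ^ 3 / Real.sqrt β) / β := by
    rw [hmdef, show (10 ^ 8 * S ^ 2 * (A / Real.sqrt β)) ^ 3 = (10 ^ 8) ^ 3 * S ^ 6 * (A ^ 3 / (Real.sqrt β ^ 2 * Real.sqrt β)) by ring,
      hsβsq]
    field_simp
  set R : ℝ := A / 2 with hRdef
  set R' : ℝ := A / 4 with hR'def
  have hR0 : 0 ≤ R := by positivity
  have hR'0 : 0 ≤ R' := by positivity
  -- (hm) the link bound dominates the T4 expression
  have hm_ge : Real.sqrt 2 * ((12 * (H : ℝ) ^ 2 + 2 * H + 1) * (Real.sqrt (β ^ (2 * (4 * θ) - 1)) + 8 * r)) ≤ m := by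
    rw [hsqrtε, hmdef]
    have ha0 : 0 ≤ A / Real.sqrt β := by positivity
    have hr' : r ≤ 278400 * 2 * (A / Real.sqrt β) := by
      refine hrle.trans ?_
      have : 278400 * Real.sqrt 2 * A / Real.sqrt β = Real.sqrt 2 * (278400 * (A / Real.sqrt β)) := by ring
      rw [this]
      nlinarith only [sqrt_two_le_two, Real.sqrt_nonneg 2, ha0]
    have hsum : A / Real.sqrt β + 8 * r ≤ 4454401 * (A / Real.sqrt β) := by linarith only [hr']
    calc Real.sqrt 2 * ((12 * (H : ℝ) ^ 2 + 2 * H + 1) * (A / Real.sqrt β + 8 * r))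
        ≤ 2 * ((12 * (H : ℝ) ^ 2 + 2 * H + 1) * (A / Real.sqrt β + 8 * r)) :=
          mul_le_mul_of_nonneg_right sqrt_two_le_two (by positivity)
      _ ≤ 2 * ((3 * S ^ 2) * (4454401 * (A / Real.sqrt β))) := by gcongr
      _ ≤ 10 ^ 8 * S ^ 2 * (A / Real.sqrt β) := by linarith only [mul_nonneg (sq_nonneg S) ha0]
  -- (hmE) the sandwich's link window
  have hmE : r ^ 2 + 3 * ((12 * (H : ℝ) ^ 2 + 2 * H + 1) * ((R + R') + 4 * (Real.sqrt (2 * β) * r))) ^ 2 / (2 * β) ≤ m ^ 2 := by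
    rw [hsr, hm2, hRdef, hR'def]
    have hr2 : r ^ 2 ≤ 2 * 278400 ^ 2 * (A ^ 2 / β) := by
      rw [hr2eq, hDsq]
      gcongr
    have hinner : (12 * (H : ℝ) ^ 2 + 2 * H + 1) * ((A / 2 + A / 4) + 4 * (556800 * D)) ≤ (3 * S ^ 2) * (2227201 * A) := by
      have h1 : (A / 2 + A / 4) + 4 * (556800 * D) ≤ 2227201 * A := by linarith only [hDA, hD0, hA0]
      exact mul_le_mul hL h1 (by positivity) (by positivity)
    have hinner0 : 0 ≤ (12 * (H : ℝ) ^ 2 + 2 * H + 1) * ((A / 2 + A / 4) + 4 * (556800 * D)) := by positivity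
    have h3 : 3 * ((12 * (H : ℝ) ^ 2 + 2 * H + 1) * ((A / 2 + A / 4) + 4 * (556800 * D))) ^ 2 / (2 * β) ≤
        3 * ((3 * S ^ 2) * (2227201 * A)) ^ 2 / (2 * β) := by
      have hsq := pow_le_pow_left₀ hinner0 hinner 2
      gcongr
    have hS4 : (1 : ℝ) ≤ S ^ 4 := one_le_pow₀ hS1
    have hAβ : 0 ≤ A ^ 2 / β := by positivity
    have hSA : 0 ≤ S ^ 4 * (A ^ 2 / β) := by positivity
    calc r ^ 2 + 3 * ((12 * (H : ℝ) ^ 2 + 2 * H + 1) * ((A / 2 + A / 4) + 4 * (556800 * D))) ^ 2 / (2 * β)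
        ≤ 2 * 278400 ^ 2 * (A ^ 2 / β) + 3 * ((3 * S ^ 2) * (2227201 * A)) ^ 2 / (2 * β) := add_le_add hr2 h3
      _ = 2 * 278400 ^ 2 * (A ^ 2 / β) + 27 / 2 * 2227201 ^ 2 * (S ^ 4 * (A ^ 2 / β)) := by field_simp; ring
      _ ≤ 2 * 278400 ^ 2 * (S ^ 4 * (A ^ 2 / β)) + 27 / 2 * 2227201 ^ 2 * (S ^ 4 * (A ^ 2 / β)) := by nlinarith only [hS4, hAβ]
      _ ≤ (10 ^ 8) ^ 2 * S ^ 4 * (A ^ 2 / β) := by linarith only [hSA]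
  -- (hwinE) the sandwich's cost window
  have hwinE : 3 * (R + R') ^ 2 / (2 * β) + 362 * m ^ 3 < β ^ (2 * (4 * θ) - 1) := by
    rw [hεeq, hm3, hRdef, hR'def]
    have hAβ : 0 < A ^ 2 / β := by positivity
    have h1 : 362 * ((10 ^ 8) ^ 3 * S ^ 6 * (A ^ 3 / Real.sqrt β) / β) ≤ 1 / 7 * (A ^ 2 / β) := by
      have key : 362 * ((10 ^ 8) ^ 3 * S ^ 6 * (A ^ 3 / Real.sqrt β) / β) =
          1 / 7 * (7 * 362 * (10 ^ 8) ^ 3 * S ^ 6 * (A / Real.sqrt β)) * (A ^ 2 / β) := by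
        field_simp
      rw [key]
      nlinarith only [e7, hAβ.le]
    have h2 : 3 * (A / 2 + A / 4) ^ 2 / (2 * β) = 27 / 32 * (A ^ 2 / β) := by field_simp; ring
    rw [h2]
    linarith only [h1, hAβ]
  -- (hp2) the Gaussian bad mass bound is ≤ 1/2
  have hexpR : Real.exp (-R ^ 2 / 2) ≤ Real.exp (-(2 * β ^ (7 * θ))) := by
    rw [Real.exp_le_exp, hRdef]
    have h3 : -(A / 2) ^ 2 / 2 = -(A ^ 2 / 8) := by ring
    rw [h3]; linarith only [hA2ge]
  have hexp1 : Real.exp (-(2 * β ^ (7 * θ))) ≤ Real.exp (-(β ^ (7 * θ))) := by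
    rw [Real.exp_le_exp]; have : 0 ≤ β ^ (7 * θ) := Real.rpow_nonneg hβ0.le _; linarith only [this]
  have hp2 : 720 * (2 * (H : ℝ) + 1) ^ 4 * Real.exp (-R ^ 2 / 2) ≤ 1 / 2 := by
    have : 720 * (2 * (H : ℝ) + 1) ^ 4 * Real.exp (-R ^ 2 / 2) ≤ 720 * S ^ 4 * Real.exp (-(β ^ (7 * θ))) :=
      mul_le_mul (by gcongr) (hexpR.trans hexp1) (Real.exp_pos _).le (by positivity)
    linarith only [this, e11]
  -- (hF) the background circulations vanish, so they are ≤ R'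
  have hF : ∀ (c : Fin 3) (p : ZdPlaquette 4), |sCirc (glue (pin := fun e => e ∉ dirFreeEdges H) dirCorner (2 * H + 3)
      (sdat β (0 : Fin 3 → Literature.MathematicalPhysics.QuantumLattice.ZdEdge 4 → ℝ) c)
      (mean (fun e => e ∉ dirFreeEdges H) dirCorner (2 * H + 3)
        (sdat β (0 : Fin 3 → Literature.MathematicalPhysics.QuantumLattice.ZdEdge 4 → ℝ) c))) (p.1, p.2.1.1, p.2.1.2)| ≤ R' := by
    intro c p
    rw [sdat_zero, Pi.zero_apply, sCirc_glue_zero_mean_zero H, abs_zero]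
    exact hR'0
  -- (hbad) the YM bad mass of the cold wall
  have hbad : (boxKernel β H (fun _ => 1)).real (coldGoodSet β (4 * θ) H)ᶜ ≤ Real.exp (-A) := by
    rw [coldGoodSet, compl_compl, boxKernel_one]
    exact hrareβ
  have hpY1 : Real.exp (-A) < 1 := by rw [Real.exp_lt_one_iff]; linarith only [hA0]
  -- the deterministic instantiated core at the flat datum
  have hcore := abs_kernelMean_sub_le_of_trunk (ε := 4 * θ) hβ0 hH1 hr0 hR0 hR'0 (one_eq_gnomonicChart_zero H) hϑ' hforest hF hbad hpY1
    hm_ge hm4 hmE hwinE hp2 hij hxt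
  rw [boxKernel_one] at hcore
  -- the background terms vanish
  have hF0 : ∀ c : Fin 3, Real.sqrt (2 * β) * sCirc (glue (pin := fun e => e ∉ dirFreeEdges H) dirCorner (2 * H + 3)
      ((0 : Fin 3 → Literature.MathematicalPhysics.QuantumLattice.ZdEdge 4 → ℝ) c)
      (mean (fun e => e ∉ dirFreeEdges H) dirCorner (2 * H + 3)
        ((0 : Fin 3 → Literature.MathematicalPhysics.QuantumLattice.ZdEdge 4 → ℝ) c))) (x, i, j) = 0 := by
    intro c; rw [Pi.zero_apply, sCirc_glue_zero_mean_zero H, mul_zero]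
  have hs2 : ∑ c : Fin 3, (Real.sqrt (2 * β) * sCirc (glue (pin := fun e => e ∉ dirFreeEdges H) dirCorner (2 * H + 3)
      ((0 : Fin 3 → Literature.MathematicalPhysics.QuantumLattice.ZdEdge 4 → ℝ) c)
      (mean (fun e => e ∉ dirFreeEdges H) dirCorner (2 * H + 3)
        ((0 : Fin 3 → Literature.MathematicalPhysics.QuantumLattice.ZdEdge 4 → ℝ) c))) (x, i, j)) ^ 2 = 0 := by
    refine Finset.sum_eq_zero fun c _ => ?_
    rw [hF0 c]; simp
  have hs4 : ∑ c : Fin 3, ((Real.sqrt (2 * β) * sCirc (glue (pin := fun e => e ∉ dirFreeEdges H) dirCorner (2 * H + 3)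
      ((0 : Fin 3 → Literature.MathematicalPhysics.QuantumLattice.ZdEdge 4 → ℝ) c)
      (mean (fun e => e ∉ dirFreeEdges H) dirCorner (2 * H + 3)
        ((0 : Fin 3 → Literature.MathematicalPhysics.QuantumLattice.ZdEdge 4 → ℝ) c))) (x, i, j)) ^ 4 +
      3 * boxDirProjKernel H (x, i, j) (x, i, j) ^ 2) = 3 * (3 * boxDirProjKernel H (x, i, j) (x, i, j) ^ 2) := by
    have h : ∀ c : Fin 3, (Real.sqrt (2 * β) * sCirc (glue (pin := fun e => e ∉ dirFreeEdges H) dirCorner (2 * H + 3)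
      ((0 : Fin 3 → Literature.MathematicalPhysics.QuantumLattice.ZdEdge 4 → ℝ) c)
      (mean (fun e => e ∉ dirFreeEdges H) dirCorner (2 * H + 3)
        ((0 : Fin 3 → Literature.MathematicalPhysics.QuantumLattice.ZdEdge 4 → ℝ) c))) (x, i, j)) ^ 4 +
      3 * boxDirProjKernel H (x, i, j) (x, i, j) ^ 2 = 3 * boxDirProjKernel H (x, i, j) (x, i, j) ^ 2 := by
      intro c; rw [hF0 c]; simp
    rw [Finset.sum_congr rfl fun c _ => h c, Finset.sum_const, Finset.card_univ, Fintype.card_fin, nsmul_eq_mul]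
    push_cast; ring
  rw [hs2, mul_zero, add_zero, hs4] at hcore
  refine hcore.trans ?_
  -- bookkeeping of the four error terms (as in the route's stub, with `Q = 9 C_D²`)
  have hC1 : boxDirProjKernel H (x, i, j) (x, i, j) ≤ 1 := by
    have hq := unshift_mem_plaquettesIn hxt
    have h := boxDirProjKernel_le_one_of_mem (H := H) hq hq
    have hs : Plaq.shift dirCorner ((x - dirCorner, i, j) : Plaq 4) = (x, i, j) := by simp [Plaq.shift]
    simpa only [hs] using h
  have hC0 : 0 ≤ boxDirProjKernel H (x, i, j) (x, i, j) := by
    have hpq : boxDirProjKernel H (x, i, j) (x, i, j) =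
        ∫ s, dirCirc H (x, i, j) s * dirCirc H (x, i, j) s ∂(boxDirichlet H) := (integral_dirCirc_mul _ _).symm
    rw [hpq]
    exact integral_nonneg fun s => mul_self_nonneg _
  -- keep the arithmetic tactics away from the matrix inverse behind `boxDirProjKernel`
  generalize hCdef : boxDirProjKernel H (x, i, j) (x, i, j) = C at hC0 hC1 ⊢
  -- (ii) cardinalities
  have hP : (#(plaquettesTouching (boxEdges 4 (2 * H + 1))) : ℝ) ≤ 120 * S ^ 4 := by
    have h := card_plaquettesTouching_boxEdges_le (2 * H + 1)
    have h' : ((#(plaquettesTouching (boxEdges 4 (2 * H + 1))) : ℕ) : ℝ) ≤ ((120 * (2 * H + 1) ^ 4 : ℕ) : ℝ) := by exact_mod_cast h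
    push_cast at h'
    linarith only [h', h4S]
  have hN : (Fintype.card (ColdFreeIdx H) : ℝ) ≤ 4 * S ^ 4 := by
    have h1 : Fintype.card (ColdFreeIdx H) ≤ Fintype.card ↥(boxEdges 4 (2 * H + 1)) := Fintype.card_subtype_le _
    rw [Fintype.card_coe] at h1
    have h2 := card_boxEdges_four_le (2 * H + 1)
    have h' : ((Fintype.card (ColdFreeIdx H) : ℕ) : ℝ) ≤ ((4 * (2 * H + 1) ^ 4 : ℕ) : ℝ) := by exact_mod_cast h1.trans h2
    push_cast at h'
    linarith only [h', h4S]
  -- (iii) the tilt size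
  have hw_le : (#(plaquettesTouching (boxEdges 4 (2 * H + 1))) : ℝ) * (362 * β * m ^ 3) + 2 * (Fintype.card (ColdFreeIdx H) : ℝ) * m ^ 2 ≤
      43440 * (10 ^ 8) ^ 3 * S ^ 10 * (A ^ 3 / Real.sqrt β) + 8 * (10 ^ 8) ^ 2 * S ^ 8 * (A ^ 2 / β) := by
    rw [hm2, hm3]
    have h1 : (#(plaquettesTouching (boxEdges 4 (2 * H + 1))) : ℝ) * (362 * β * ((10 ^ 8) ^ 3 * S ^ 6 * (A ^ 3 / Real.sqrt β) / β)) ≤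
        120 * S ^ 4 * (362 * β * ((10 ^ 8) ^ 3 * S ^ 6 * (A ^ 3 / Real.sqrt β) / β)) :=
      mul_le_mul_of_nonneg_right hP (by positivity)
    have h2 : 2 * (Fintype.card (ColdFreeIdx H) : ℝ) * ((10 ^ 8) ^ 2 * S ^ 4 * (A ^ 2 / β)) ≤
        2 * (4 * S ^ 4) * ((10 ^ 8) ^ 2 * S ^ 4 * (A ^ 2 / β)) := by gcongr
    have e : 120 * S ^ 4 * (362 * β * ((10 ^ 8) ^ 3 * S ^ 6 * (A ^ 3 / Real.sqrt β) / β)) =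
        43440 * (10 ^ 8) ^ 3 * S ^ 10 * (A ^ 3 / Real.sqrt β) := by
      field_simp; ring
    have e' : 2 * (4 * S ^ 4) * ((10 ^ 8) ^ 2 * S ^ 4 * (A ^ 2 / β)) = 8 * (10 ^ 8) ^ 2 * S ^ 8 * (A ^ 2 / β) := by ring
    linarith only [h1, h2, e, e']
  have hw0 : 0 ≤ (#(plaquettesTouching (boxEdges 4 (2 * H + 1))) : ℝ) * (362 * β * m ^ 3) + 2 * (Fintype.card (ColdFreeIdx H) : ℝ) * m ^ 2 :=
    add_nonneg (mul_nonneg (Nat.cast_nonneg _) (by positivity)) (mul_nonneg (mul_nonneg (by norm_num) (Nat.cast_nonneg _)) (sq_nonneg _))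
  have hw_half : (#(plaquettesTouching (boxEdges 4 (2 * H + 1))) : ℝ) * (362 * β * m ^ 3) + 2 * (Fintype.card (ColdFreeIdx H) : ℝ) * m ^ 2 ≤
      1 / 2 := by linarith only [hw_le, e2, e3]
  have hAw : 16 * A ^ 2 * ((#(plaquettesTouching (boxEdges 4 (2 * H + 1))) : ℝ) * (362 * β * m ^ 3) +
      2 * (Fintype.card (ColdFreeIdx H) : ℝ) * m ^ 2) ≤ β ^ (-θ) := by
    have h1 : 16 * A ^ 2 * (43440 * (10 ^ 8) ^ 3 * S ^ 10 * (A ^ 3 / Real.sqrt β)) =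
        1 / 2 * (32 * 43440 * (10 ^ 8) ^ 3 * S ^ 10 * (A ^ 5 / Real.sqrt β)) := by
      field_simp; ring
    have h2 : 16 * A ^ 2 * (8 * (10 ^ 8) ^ 2 * S ^ 8 * (A ^ 2 / β)) = 1 / 2 * (32 * 8 * (10 ^ 8) ^ 2 * S ^ 8 * (A ^ 4 / β)) := by
      field_simp; ring
    have hA2pos : 0 ≤ 16 * A ^ 2 := by positivity
    calc 16 * A ^ 2 * ((#(plaquettesTouching (boxEdges 4 (2 * H + 1))) : ℝ) * (362 * β * m ^ 3) +
          2 * (Fintype.card (ColdFreeIdx H) : ℝ) * m ^ 2)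
        ≤ 16 * A ^ 2 * (43440 * (10 ^ 8) ^ 3 * S ^ 10 * (A ^ 3 / Real.sqrt β) + 8 * (10 ^ 8) ^ 2 * S ^ 8 * (A ^ 2 / β)) :=
          mul_le_mul_of_nonneg_left hw_le hA2pos
      _ = 1 / 2 * (32 * 43440 * (10 ^ 8) ^ 3 * S ^ 10 * (A ^ 5 / Real.sqrt β)) + 1 / 2 * (32 * 8 * (10 ^ 8) ^ 2 * S ^ 8 * (A ^ 4 / β)) := by
          rw [mul_add, h1, h2]
      _ ≤ 1 / 2 * β ^ (-θ) + 1 / 2 * β ^ (-θ) := by linarith only [e4, e5]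
      _ = β ^ (-θ) := by ring
  -- name the tilt exponent
  generalize hwdef : (#(plaquettesTouching (boxEdges 4 (2 * H + 1))) : ℝ) * (362 * β * m ^ 3) +
      2 * (Fintype.card (ColdFreeIdx H) : ℝ) * m ^ 2 = w at hw0 hw_half hAw ⊢
  -- term 1: YM conditioning
  have t1 : 2 * (4 * β) * Real.exp (-A) ≤ β ^ (-θ) / 4 := by linarith only [e9]
  -- term 2: the tilt
  have t2 : β ^ (2 * (4 * θ)) * (Real.exp (2 * w) - 1) ≤ β ^ (-θ) / 4 := by
    rw [hA2]
    have habs : |2 * w| ≤ 1 := by rw [abs_of_nonneg (by linarith only [hw0])]; linarith only [hw_half]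
    have h := Real.abs_exp_sub_one_le habs
    rw [abs_of_nonneg (by linarith only [hw0] : (0 : ℝ) ≤ 2 * w)] at h
    have h' : Real.exp (2 * w) - 1 ≤ 4 * w := by linarith only [h, le_abs_self (Real.exp (2 * w) - 1)]
    calc A ^ 2 * (Real.exp (2 * w) - 1) ≤ A ^ 2 * (4 * w) := mul_le_mul_of_nonneg_left h' (by positivity)
      _ ≤ β ^ (-θ) / 4 := by linarith only [hAw]
  -- term 3: linearisation
  have t3 : 362 * β * m ^ 3 ≤ β ^ (-θ) / 4 := by
    rw [hm3]
    have e : 362 * β * ((10 ^ 8) ^ 3 * S ^ 6 * (A ^ 3 / Real.sqrt β) / β) = 362 * ((10 ^ 8) ^ 3 * S ^ 6 * (A ^ 3 / Real.sqrt β)) := by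
      rw [mul_assoc, ← mul_div_assoc, mul_div_cancel_left₀ _ hβ0.ne']
    rw [e]; linarith only [e6]
  -- term 4: the Gaussian moments × √p  (`1 + 6·(3·3·C_D²) ≤ 55 ≤ 56 A⁴`)
  have t4 : 2 * (1 + 6 * (3 * (3 * C ^ 2))) *
      Real.sqrt (720 * (2 * (H : ℝ) + 1) ^ 4 * Real.exp (-R ^ 2 / 2)) ≤ β ^ (-θ) / 4 := by
    have hq : 1 + 6 * (3 * (3 * C ^ 2)) ≤ 56 * A ^ 4 := by
      have hA4' : 1 ≤ A ^ 4 := one_le_pow₀ hA1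
      have h2 : C ^ 2 ≤ 1 := by nlinarith only [hC0, hC1]
      linarith only [h2, hA4']
    have hsq : Real.sqrt (720 * (2 * (H : ℝ) + 1) ^ 4 * Real.exp (-R ^ 2 / 2)) ≤ 27 * S ^ 2 * Real.exp (-(β ^ (7 * θ))) := by
      have h1 : 720 * (2 * (H : ℝ) + 1) ^ 4 * Real.exp (-R ^ 2 / 2) ≤ (27 * S ^ 2 * Real.exp (-(β ^ (7 * θ)))) ^ 2 := by
        have he : Real.exp (-(β ^ (7 * θ))) ^ 2 = Real.exp (-(2 * β ^ (7 * θ))) := by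
          rw [← Real.exp_nat_mul]; congr 1; push_cast; ring
        rw [mul_pow, mul_pow, he, show (S ^ 2) ^ 2 = S ^ 4 by ring]
        calc 720 * (2 * (H : ℝ) + 1) ^ 4 * Real.exp (-R ^ 2 / 2) ≤ 720 * S ^ 4 * Real.exp (-(2 * β ^ (7 * θ))) :=
              mul_le_mul (by gcongr) hexpR (Real.exp_pos _).le (by positivity)
          _ ≤ 27 ^ 2 * S ^ 4 * Real.exp (-(2 * β ^ (7 * θ))) := by gcongr; norm_num
      calc Real.sqrt (720 * (2 * (H : ℝ) + 1) ^ 4 * Real.exp (-R ^ 2 / 2)) ≤ Real.sqrt ((27 * S ^ 2 * Real.exp (-(β ^ (7 * θ)))) ^ 2) :=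
            Real.sqrt_le_sqrt h1
        _ = 27 * S ^ 2 * Real.exp (-(β ^ (7 * θ))) := Real.sqrt_sq (by positivity)
    have hq0 : 0 ≤ 1 + 6 * (3 * (3 * C ^ 2)) := by positivity
    calc 2 * (1 + 6 * (3 * (3 * C ^ 2))) * Real.sqrt (720 * (2 * (H : ℝ) + 1) ^ 4 * Real.exp (-R ^ 2 / 2))
        ≤ 2 * (56 * A ^ 4) * (27 * S ^ 2 * Real.exp (-(β ^ (7 * θ)))) :=
          mul_le_mul (mul_le_mul_of_nonneg_left hq (by norm_num)) hsq (Real.sqrt_nonneg _) (by positivity)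
      _ = 3024 * (A ^ 4 * S ^ 2) * Real.exp (-(β ^ (7 * θ))) := by ring
      _ ≤ 3024 * (A ^ 4 * (49 * β ^ (2 * θ))) * Real.exp (-(β ^ (7 * θ))) := by gcongr
      _ = 1 / 4 * (12096 * 49 * (A ^ 4 * β ^ (2 * θ)) * Real.exp (-(β ^ (7 * θ)))) := by ring
      _ ≤ β ^ (-θ) / 4 := by linarith only [e10]
  linarith only [t1, t2, t3, t4]

/-! ### §2 One-sided readings: the pointwise cold-wall ceiling, uniformly on the polynomial window -/

/-- **THE POINTWISE COLD-WALL CEILING, UNIFORMLY ON THE POLYNOMIAL WINDOW.**  For `0 < θ ≤ 1/100`: eventually in `β`, for all `1 ≤ H ≤ ⌈β^θ⌉` and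
every plaquette `q` touching the cold-wall box, `∫ (2 − Re tr U_q) d(boxState β H) ≤ 5/(2β)` (`(3/2)·C_D ≤ 3/2`, `β^{−θ} ≤ 1`). [folklore] -/
theorem coldWall_kernelMean_le {θ : ℝ} (hθ : 0 < θ) (hθ₂ : θ ≤ 1 / 100) :
    ∃ β₀ : ℝ, 0 < β₀ ∧ ∀ β : ℝ, β₀ ≤ β → ∀ H : ℕ, 1 ≤ H → H ≤ ⌈β ^ θ⌉₊ →
      ∀ (x : Site 4) (i j : Fin 4) (hij : i < j),
        ((x, ⟨(i, j), hij⟩) : ZdPlaquette 4) ∈ plaquettesTouching (boxEdges 4 (2 * H + 1)) →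
        ∫ U, plaqCostAt (fundamentalRep (Fin 2)) x i j U ∂(boxState (fundamentalRep (Fin 2)) β H) ≤ 5 / (2 * β) := by
  obtain ⟨β₀, h⟩ := coldWall_kernelMean_sub_le hθ hθ₂
  refine ⟨max β₀ 1, lt_of_lt_of_le one_pos (le_max_right _ _), fun β hβ H hH1 hHc x i j hij hxt => ?_⟩
  have hβ1 : 1 ≤ β := (le_max_right _ _).trans hβ
  have hβ0 : 0 < β := by linarith
  have hm := h β ((le_max_left _ _).trans hβ) H hH1 hHc x i j hij hxt
  have hC1 : boxDirProjKernel H (x, i, j) (x, i, j) ≤ 1 := by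
    have hq := unshift_mem_plaquettesIn hxt
    have h := boxDirProjKernel_le_one_of_mem (H := H) hq hq
    have hs : Plaq.shift dirCorner ((x - dirCorner, i, j) : Plaq 4) = (x, i, j) := by simp [Plaq.shift]
    simpa only [hs] using h
  have hθ1 : β ^ (-θ) ≤ 1 := Real.rpow_le_one_of_one_le_of_nonpos hβ1 (by linarith)
  have hup := (abs_le.1 hm).2
  generalize hCdef : boxDirProjKernel H (x, i, j) (x, i, j) = C at hup hC1
  generalize hIdef : ∫ U, plaqCostAt (fundamentalRep (Fin 2)) x i j U ∂(boxState (fundamentalRep (Fin 2)) β H) = I at hup ⊢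
  rw [le_div_iff₀ (by positivity)]
  nlinarith [hup, hC1, hθ1]

/-- The matching FLOOR reading: `β · ∫ (2 − Re tr U_q) d(boxState β H) ≥ (3/2)·C_{D,H}(q,q) − β^{−θ}`. [folklore] -/
theorem coldWall_kernelMean_ge {θ : ℝ} (hθ : 0 < θ) (hθ₂ : θ ≤ 1 / 100) :
    ∃ β₀ : ℝ, ∀ β : ℝ, β₀ ≤ β → ∀ H : ℕ, 1 ≤ H → H ≤ ⌈β ^ θ⌉₊ →
      ∀ (x : Site 4) (i j : Fin 4) (hij : i < j),
        ((x, ⟨(i, j), hij⟩) : ZdPlaquette 4) ∈ plaquettesTouching (boxEdges 4 (2 * H + 1)) →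
        3 / 2 * boxDirProjKernel H (x, i, j) (x, i, j) - β ^ (-θ) ≤
          β * ∫ U, plaqCostAt (fundamentalRep (Fin 2)) x i j U ∂(boxState (fundamentalRep (Fin 2)) β H) := by
  obtain ⟨β₀, h⟩ := coldWall_kernelMean_sub_le hθ hθ₂
  refine ⟨β₀, fun β hβ H hH1 hHc x i j hij hxt => ?_⟩
  have hm := (abs_le.1 (h β hβ H hH1 hHc x i j hij hxt)).1
  generalize hCdef : boxDirProjKernel H (x, i, j) (x, i, j) = C at hm ⊢
  generalize hIdef : ∫ U, plaqCostAt (fundamentalRep (Fin 2)) x i j U ∂(boxState (fundamentalRep (Fin 2)) β H) = I at hm ⊢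
  linarith [hm]

end Summit.QuantumFields.YangMills.Cruxes.UVSeamRec.ClassicalResponse.ColdWall

end
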